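/-
Copyright (c) 2026. All rights reserved.
Released under Apache 2.0 license as described in the file LICENSE.
-/
import Literature.MathematicalPhysics.QuantumLattice.HartreeFockBlochTorus
import Literature.MathematicalPhysics.QuantumLattice.HubbardNNNHoppingInteractionTorus
import HarnessLib

/-!
# Hartree–Fock upper bounds from Bloch (magnetic-cell periodic) Slater states for the `t–t'`
# Hubbard model on the square torus: the cell expression of the DIAGONAL bonds

Topic `MathematicalPhysics/QuantumLattice`, family `hubbard`; the `t' ≠ 0` continuation of
`HartreeFockBlochTorus.lean` (which is deliberately `t' = 0`). There, for the Hubbard torus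
`(ℤ/Lℤ)^d` cut into `Π k i` cells of sides `M i` and a collinear Bloch state with cell-momentum blocks
`Q σ κ`, the Hartree–Fock functional is the cell expression `blochEnergy t U Q` (nearest-neighbour
bonds with the face phases `θ_κ,i(x̄) = facePhase κ i x̄`, `= χ_κ(eᵢ)` on bonds leaving the cell
through face `i`, `= 1` inside). Here `d = 2` and the published `t–t'` Hamiltonian
`hubbardTorusTT' L t t' U = hamiltonian (n.n. graph) t U + hamiltonian (diagonal graph) t' 0`
(Xu et al. 2024 eq. (1); `HubbardNNNHopping.lean`) gains the next-nearest-neighbour bonds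
`x ∼ x ± (e₀ + e₁)`, `x ∼ x ± (e₀ - e₁)`. Results (all real `t, t', U`, `L ≥ 3`):

* `trace_hopMatrix_diag_mul_eq` — the diagonal kinetic trace of any one-body matrix `P` in plaquette
  form: `tr (K'_{-t'} P) = -t' Σ_x [P(x+e₀+e₁, x) + P(x, x+e₀+e₁) + P(x+e₀, x+e₁) + P(x+e₁, x+e₀)]`
  (the four diagonal neighbours are distinct for `L ≥ 3`, `sum_ite_torusDiagGraph_adj`; the
  `e₀ - e₁` bonds are re-based at the plaquette corner);
* **`blochDiag`** and **`hfEnergy_diag_blochState`** — for the Bloch matrix of blocks `Q σ κ` this is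
  the CELL expression
  `blochDiag Q = Σ_σ Σ_κ Σ_{x̄} [θ₀θ₁ Q(x̄+e₀+e₁, x̄) + conj(θ₀θ₁) Q(x̄, x̄+e₀+e₁)`
  `                              + θ₀ conj θ₁ Q(x̄+e₀, x̄+e₁) + conj θ₀ θ₁ Q(x̄+e₁, x̄+e₀)]`
  (`θᵢ = facePhase κ i x̄`; a diagonal bond crossing both faces picks up both phases):
  `hfEnergy (diagonal graph) t' 0 (Bloch P) = -t' · blochDiag Q`;
* `groundEnergy_twoGraph_le_hfEnergy` — the Hartree–Fock bound `E₀(N) ≤ re [E_HF^G + E_HF^{G'}]` for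
  any two-graph Hamiltonian `hamiltonian G t U + hamiltonian G' t' U'` (generic vertex type);
* **`blochEnergyTT'`** `= blochEnergy t U Q - t' · blochDiag Q` and
  **`hubbardTorusTT'_groundEnergy_le_blochTT'`** — `E_{(ℤ/Lℤ)²}(t,t',U;N) ≤ re blochEnergyTT'` for every
  family of Hermitian idempotent blocks with `Σ tr Q σ κ = N` (the quasi-free ground state of
  `dΓ(1 - 2P)` and the tree's variational principle `groundEnergy_le_re_groundStateFunctional`, valid for
  ANY operator, applied to the two-graph Hamiltonian; BLS94 (2c.36)).

This is the finite-torus layer of the soundness theorem of translation-invariant quasi-free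
certificates for the `t–t'` model (the `t'`-slot of FORMAT-qf1: the diagonal-bond Wick term); the
Lieb principle for `0 ≤ Q ≤ 1` and the certificate's kernel form follow in
`HartreeFockBlochMixtureTTPrime.lean` / `HartreeFockQuasiFreeCertificateTTPrime.lean`.
Deliberately NOT here: `d ≠ 2` (the diagonal graph is two-dimensional), the thermodynamic limit.

Everything is proved; the definitions (`blochDiag`, `blochEnergyTT'`, `shiftEquiv`) have bodies; no
named facts.

## Mathlib / tree search

Tree (REUSED): `blochMatrix`, `blochMatrix_apply`, `cellIndex`, `cellPos`, `stepSite`, `facePhase`,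
`blockChar_cellIndex_stepSite_sub`, `cellPos_stepSite`, `blockChar_add_right`, `blockChar_sub_right`,
`blockChar_neg_right`, `sum_eq_sum_cell`, `card_cells_ne_zero`, `hfEnergy_blochState`, `blochEnergy`,
`conjTranspose_blochMatrix`, `blochMatrix_mul`, `trace_blochMatrix` (`HartreeFockBlochTorus`);
`spinBlock`, `hfEnergy_spinBlock`, `conjTranspose_spinBlock`, `spinBlock_mul_spinBlock`,
`trace_spinBlock` (`HartreeFockSDWTorus`); `groundEnergy_le_re_groundStateFunctional`,
`groundStateFunctional_hamiltonian`, `hfOneBody` (`HartreeFockUpperBound`); `hubbardTorusTT'`,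
`torusDiagJump`, `fermionTorusDiagGraph_adj`, `sum_ite_torusDiagGraph_adj`
(`HubbardNNNHopping(InteractionTorus)`); `FermionTorus.sum_eq_sum_torusSite`, `equivTorusSite`.
`lean search 'blochDiag|blochEnergyTT|diag.*blochMatrix'`: nothing — the Bloch files are `t' = 0`.

## References

* V. Bach, E. H. Lieb, J. P. Solovej, *Generalized Hartree–Fock theory and the Hubbard model*,
  J. Stat. Phys. 76 (1994) 3, eqs. (2c.8), (2c.36), (3a.2). [BachLiebSolovej1994]
* H. Xu et al., Science 384 (2024) eadh7691, eq. (1) (the `t–t'` Hamiltonian). [XuEtAl2024]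
-/

noncomputable section

namespace Literature.MathematicalPhysics.QuantumLattice

namespace HartreeFock

open Matrix Finset Literature.Probability.LatticeModels HeisenbergTL
  Literature.MathematicalPhysics.QuantumLattice.LangerMattis
open scoped ComplexConjugate

/-! ### The Hartree–Fock bound for a two-graph Hamiltonian -/

section TwoGraph

variable {Λ : Type*} [LinearOrder Λ] [Fintype Λ] (G G' : SimpleGraph Λ) [DecidableRel G.Adj]
  [DecidableRel G'.Adj]

/-- **Hartree–Fock (Slater-determinant) upper bound for a two-graph Hubbard Hamiltonian**
`hamiltonian G t U + hamiltonian G' t' U'` (e.g. the `t–t'` model: `G` the nearest-neighbour and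
`G'` the diagonal bonds, `U' = 0`): for every orthogonal projection `P` with `tr P = N`,
`E₀(N) ≤ re [E_HF^G(t,U;P) + E_HF^{G'}(t',U';P)]` — the quasi-free ground state of `dΓ(1 - 2P)`
evaluates BOTH graph Hamiltonians by their Hartree–Fock functionals
(`groundStateFunctional_hamiltonian`) and the variational principle
`groundEnergy_le_re_groundStateFunctional` holds for any operator. BLS94 (2c.36).
[cite: BachLiebSolovej1994, eq. (2c.36)] -/
theorem groundEnergy_twoGraph_le_hfEnergy (t U t' U' : ℝ) {P : Matrix (Orb Λ) (Orb Λ) ℂ}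
    (hP : P.IsHermitian) (hPP : P * P = P) {N : ℕ} (htr : P.trace = N) :
    groundEnergy (hamiltonian G t U + hamiltonian G' t' U') N ≤
      (hfEnergy G t U P + hfEnergy G' t' U' P).re := by
  rw [← groundStateFunctional_hamiltonian G hP hPP t U, ← groundStateFunctional_hamiltonian G' hP hPP t' U',
    ← map_add]
  exact groundEnergy_le_re_groundStateFunctional hP hPP htr _

end TwoGraph

/-! ### Diagonal steps on the fermionic torus -/

section Steps

variable {L : ℕ} [NeZero L]

/-- Translating the whole torus `(ℤ/Lℤ)²` by a vector `v` is a bijection of the fermionic torus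
(the tree's `stepEquiv i` is the case `v = eᵢ`). [folklore] -/
def shiftEquiv (v : TorusSite 2 L) : FermionTorus 2 L ≃ FermionTorus 2 L :=
  FermionTorus.equivTorusSite.trans ((Equiv.addRight v).trans FermionTorus.equivTorusSite.symm)

/-- `shiftEquiv v x = x + v`. [folklore] -/
private theorem shiftEquiv_apply (v : TorusSite 2 L) (x : FermionTorus 2 L) :
    shiftEquiv v x = FermionTorus.ofTorusSite (x.toTorusSite + v) := rfl

omit [NeZero L] in
/-- The diagonal jump `j₀ = e₀ + e₁` of the torus in coordinates. [folklore] -/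
private theorem torusDiagJump_zero_eq :
    torusDiagJump L 0 = Pi.single (0 : Fin 2) (1 : ZMod L) + Pi.single 1 1 := by
  funext i
  fin_cases i <;> simp [torusDiagJump]

omit [NeZero L] in
/-- The diagonal jump `j₁ = e₀ - e₁` of the torus in coordinates. [folklore] -/
private theorem torusDiagJump_one_eq :
    torusDiagJump L 1 = Pi.single (0 : Fin 2) (1 : ZMod L) - Pi.single 1 1 := by
  funext i
  fin_cases i <;> simp [torusDiagJump]

/-- `(x + e₀) + e₁ = x + j₀`. [folklore] -/
private theorem stepSite_stepSite_eq (x : FermionTorus 2 L) :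
    stepSite (stepSite x 0) 1 = FermionTorus.ofTorusSite (x.toTorusSite + torusDiagJump L 0) := by
  simp only [stepSite, FermionTorus.toTorusSite_ofTorusSite, torusDiagJump_zero_eq, add_assoc]

/-- **The diagonal kinetic trace in plaquette form** (`L ≥ 3`): for every one-body matrix `P` on the
torus, `tr (K'_{-t'} P) = -t' Σ_x [P(x+e₀+e₁, x) + P(x, x+e₀+e₁) + P(x+e₀, x+e₁) + P(x+e₁, x+e₀)]`
(`K'` the hopping matrix of the diagonal graph; the bonds `x ∼ x ± (e₀ - e₁)` are re-based at the
plaquette corner `x ↦ x + e₁`, `x ↦ x + e₀`). [cite: XuEtAl2024, eq. (1)] -/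
theorem trace_hopMatrix_diag_mul_eq (hL : 3 ≤ L) (t' : ℝ)
    (P : Matrix (FermionTorus 2 L) (FermionTorus 2 L) ℂ) :
    (hopMatrix (fermionTorusDiagGraph L) (-t') * P).trace =
      -(t' : ℂ) * ∑ x : FermionTorus 2 L,
        (P (stepSite (stepSite x 0) 1) x + P x (stepSite (stepSite x 0) 1) +
          P (stepSite x 0) (stepSite x 1) + P (stepSite x 1) (stepSite x 0)) := by
  have hkin : (hopMatrix (fermionTorusDiagGraph L) (-t') * P).trace =
      ∑ x, ∑ y, (if (fermionTorusDiagGraph L).Adj x y then -(t' : ℂ) * P y x else 0) := by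
    simp only [Matrix.trace, Matrix.diag_apply, Matrix.mul_apply, hopMatrix, Matrix.of_apply,
      ite_mul, zero_mul, Complex.ofReal_neg]
  rw [hkin]
  have hnb : ∀ x : FermionTorus 2 L,
      (∑ y, if (fermionTorusDiagGraph L).Adj x y then -(t' : ℂ) * P y x else 0) =
        ∑ s : Fin 2, (-(t' : ℂ) * P (FermionTorus.ofTorusSite (x.toTorusSite + torusDiagJump L s)) x +
          -(t' : ℂ) * P (FermionTorus.ofTorusSite (x.toTorusSite - torusDiagJump L s)) x) := by
    intro x
    rw [FermionTorus.sum_eq_sum_torusSite]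
    simp only [fermionTorusDiagGraph_adj, FermionTorus.toTorusSite_ofTorusSite]
    exact sum_ite_torusDiagGraph_adj hL x.toTorusSite
      (fun z => -(t' : ℂ) * P (FermionTorus.ofTorusSite z) x)
  simp_rw [hnb]
  rw [Finset.sum_comm, Fin.sum_univ_two, Finset.sum_add_distrib, Finset.sum_add_distrib]
  -- the four bond families, re-indexed to the plaquette corner
  have hA0 : ∑ x : FermionTorus 2 L,
      -(t' : ℂ) * P (FermionTorus.ofTorusSite (x.toTorusSite + torusDiagJump L 0)) x =
      ∑ x : FermionTorus 2 L, -(t' : ℂ) * P (stepSite (stepSite x 0) 1) x := by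
    refine Finset.sum_congr rfl fun x _ => ?_
    rw [stepSite_stepSite_eq]
  have hB0 : ∑ x : FermionTorus 2 L,
      -(t' : ℂ) * P (FermionTorus.ofTorusSite (x.toTorusSite - torusDiagJump L 0)) x =
      ∑ x : FermionTorus 2 L, -(t' : ℂ) * P x (stepSite (stepSite x 0) 1) := by
    refine Fintype.sum_equiv (shiftEquiv (-torusDiagJump L 0)) _ _ fun x => ?_
    rw [stepSite_stepSite_eq, shiftEquiv_apply, FermionTorus.toTorusSite_ofTorusSite,
      ← sub_eq_add_neg, sub_add_cancel, FermionTorus.ofTorusSite_toTorusSite]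
  have hA1 : ∑ x : FermionTorus 2 L,
      -(t' : ℂ) * P (FermionTorus.ofTorusSite (x.toTorusSite + torusDiagJump L 1)) x =
      ∑ x : FermionTorus 2 L, -(t' : ℂ) * P (stepSite x 0) (stepSite x 1) := by
    refine (Fintype.sum_equiv (shiftEquiv (Pi.single 1 1)) _ _ fun y => ?_).symm
    rw [shiftEquiv_apply, FermionTorus.toTorusSite_ofTorusSite, torusDiagJump_one_eq,
      add_add_sub_cancel]
    rfl
  have hB1 : ∑ x : FermionTorus 2 L,
      -(t' : ℂ) * P (FermionTorus.ofTorusSite (x.toTorusSite - torusDiagJump L 1)) x =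
      ∑ x : FermionTorus 2 L, -(t' : ℂ) * P (stepSite x 1) (stepSite x 0) := by
    refine (Fintype.sum_equiv (shiftEquiv (Pi.single 0 1)) _ _ fun y => ?_).symm
    have h : y.toTorusSite + Pi.single 0 1 - (Pi.single (0 : Fin 2) (1 : ZMod L) - Pi.single 1 1) =
        y.toTorusSite + Pi.single 1 1 := by abel
    rw [shiftEquiv_apply, FermionTorus.toTorusSite_ofTorusSite, torusDiagJump_one_eq, h]
    rfl
  rw [hA0, hB0, hA1, hB1, Finset.mul_sum, ← Finset.sum_add_distrib, ← Finset.sum_add_distrib,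
    ← Finset.sum_add_distrib]
  refine Finset.sum_congr rfl fun x _ => ?_
  ring

end Steps

/-! ### The cell expression of the diagonal bonds of a Bloch state -/

section Bloch

variable {L : ℕ} [NeZero L] {k M : Fin 2 → ℕ} [∀ i, NeZero (k i)] [∀ i, NeZero (M i)]
  (hkM : ∀ i, k i * M i = L)

omit [∀ i, NeZero (M i)] in
/-- A face phase in direction `1` does not see a step in direction `0` (it only reads the
coordinate `x̄₁`). [folklore] -/
private theorem facePhase_one_add_single_zero (κ : RectTorusSite k) (p : RectTorusSite M) :
    facePhase κ 1 (p + Pi.single 0 1) = facePhase κ 1 p := by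
  unfold facePhase
  have h : (p + Pi.single 0 1 : RectTorusSite M) 1 = p 1 := by
    rw [Pi.add_apply, Pi.single_eq_of_ne (by decide : (1 : Fin 2) ≠ 0), add_zero]
  rw [h]

/-- **The cell expression of the diagonal (next-nearest-neighbour) bonds of a collinear Bloch state**
on a two-dimensional torus (`Q σ κ` the cell-momentum blocks of spin `σ`, `θᵢ = facePhase κ i x̄`):
`blochDiag Q = Σ_σ Σ_κ Σ_{x̄} [θ₀θ₁ Q σ κ (x̄+e₀+e₁, x̄) + conj(θ₀θ₁) Q σ κ (x̄, x̄+e₀+e₁)`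
`  + θ₀ conj θ₁ Q σ κ (x̄+e₀, x̄+e₁) + conj θ₀ θ₁ Q σ κ (x̄+e₁, x̄+e₀)]` — the value of
`Σ_σ Σ_x [P_σ(x+e₀+e₁,x) + P_σ(x,x+e₀+e₁) + P_σ(x+e₀,x+e₁) + P_σ(x+e₁,x+e₀)]` on the Bloch matrices
`P_σ` of the blocks (`hfEnergy_diag_blochState`). [cite: BachLiebSolovej1994, eq. (2c.8)] -/
def blochDiag (Q : Fin 2 → RectTorusSite k → Matrix (RectTorusSite M) (RectTorusSite M) ℂ) : ℂ :=
  ∑ σ, ∑ κ, ∑ p : RectTorusSite M,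
    (facePhase κ 0 p * facePhase κ 1 p * Q σ κ (p + Pi.single 0 1 + Pi.single 1 1) p +
      conj (facePhase κ 0 p * facePhase κ 1 p) * Q σ κ p (p + Pi.single 0 1 + Pi.single 1 1) +
      facePhase κ 0 p * conj (facePhase κ 1 p) * Q σ κ (p + Pi.single 0 1) (p + Pi.single 1 1) +
      conj (facePhase κ 0 p) * facePhase κ 1 p * Q σ κ (p + Pi.single 1 1) (p + Pi.single 0 1))

/-- **The cell expression for the Hartree–Fock energy of a collinear Bloch state in the `t–t'`
Hubbard model**: `blochEnergyTT' t t' U Q = blochEnergy t U Q - t' · blochDiag Q`.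
[cite: BachLiebSolovej1994, eq. (2c.8)] -/
def blochEnergyTT' (t t' U : ℝ)
    (Q : Fin 2 → RectTorusSite k → Matrix (RectTorusSite M) (RectTorusSite M) ℂ) : ℂ :=
  blochEnergy t U Q - (t' : ℂ) * blochDiag Q

/-- At `t' = 0` the `t–t'` cell expression is the tree's `blochEnergy`.
[cite: BachLiebSolovej1994, eq. (2c.8)] -/
@[simp] theorem blochEnergyTT'_zero (t U : ℝ)
    (Q : Fin 2 → RectTorusSite k → Matrix (RectTorusSite M) (RectTorusSite M) ℂ) :
    blochEnergyTT' t 0 U Q = blochEnergy t U Q := by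
  simp [blochEnergyTT']

variable (Q : RectTorusSite k → Matrix (RectTorusSite M) (RectTorusSite M) ℂ)

/-- Bond entry `P(x + e₀ + e₁, x) = |k|⁻¹ Σ_κ θ₀ θ₁ Q κ (x̄+e₀+e₁, x̄)` (both faces may be crossed).
[folklore] -/
private theorem blochMatrix_diag_left (x : FermionTorus 2 L) :
    blochMatrix hkM Q (stepSite (stepSite x 0) 1) x = ((Fintype.card (RectTorusSite k) : ℂ))⁻¹ *
      ∑ κ, facePhase κ 0 (cellPos hkM x) * facePhase κ 1 (cellPos hkM x) *
        Q κ (cellPos hkM x + Pi.single 0 1 + Pi.single 1 1) (cellPos hkM x) := by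
  rw [blochMatrix_apply]
  congr 1
  refine Finset.sum_congr rfl fun κ _ => ?_
  rw [← sub_add_sub_cancel (cellIndex hkM (stepSite (stepSite x 0) 1)) (cellIndex hkM (stepSite x 0))
      (cellIndex hkM x), blockChar_add_right, blockChar_cellIndex_stepSite_sub hkM,
    blockChar_cellIndex_stepSite_sub hkM, cellPos_stepSite hkM, cellPos_stepSite hkM,
    cellPos_stepSite hkM, facePhase_one_add_single_zero, mul_comm (facePhase κ 1 _)]

/-- Bond entry `P(x, x + e₀ + e₁) = |k|⁻¹ Σ_κ conj(θ₀ θ₁) Q κ (x̄, x̄+e₀+e₁)`. [folklore] -/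
private theorem blochMatrix_diag_right (x : FermionTorus 2 L) :
    blochMatrix hkM Q x (stepSite (stepSite x 0) 1) = ((Fintype.card (RectTorusSite k) : ℂ))⁻¹ *
      ∑ κ, conj (facePhase κ 0 (cellPos hkM x) * facePhase κ 1 (cellPos hkM x)) *
        Q κ (cellPos hkM x) (cellPos hkM x + Pi.single 0 1 + Pi.single 1 1) := by
  rw [blochMatrix_apply]
  congr 1
  refine Finset.sum_congr rfl fun κ _ => ?_
  rw [← neg_sub, blockChar_neg_right,
    ← sub_add_sub_cancel (cellIndex hkM (stepSite (stepSite x 0) 1)) (cellIndex hkM (stepSite x 0))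
      (cellIndex hkM x), blockChar_add_right, blockChar_cellIndex_stepSite_sub hkM,
    blockChar_cellIndex_stepSite_sub hkM, cellPos_stepSite hkM, cellPos_stepSite hkM,
    cellPos_stepSite hkM, facePhase_one_add_single_zero, mul_comm (facePhase κ 1 _)]

/-- Bond entry `P(x + e₀, x + e₁) = |k|⁻¹ Σ_κ θ₀ conj θ₁ Q κ (x̄+e₀, x̄+e₁)`. [folklore] -/
private theorem blochMatrix_step_zero_one (x : FermionTorus 2 L) :
    blochMatrix hkM Q (stepSite x 0) (stepSite x 1) = ((Fintype.card (RectTorusSite k) : ℂ))⁻¹ *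
      ∑ κ, facePhase κ 0 (cellPos hkM x) * conj (facePhase κ 1 (cellPos hkM x)) *
        Q κ (cellPos hkM x + Pi.single 0 1) (cellPos hkM x + Pi.single 1 1) := by
  rw [blochMatrix_apply]
  congr 1
  refine Finset.sum_congr rfl fun κ _ => ?_
  rw [← sub_sub_sub_cancel_right (cellIndex hkM (stepSite x 0)) (cellIndex hkM (stepSite x 1))
      (cellIndex hkM x), blockChar_sub_right, blockChar_cellIndex_stepSite_sub hkM,
    blockChar_cellIndex_stepSite_sub hkM, cellPos_stepSite hkM, cellPos_stepSite hkM]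

/-- Bond entry `P(x + e₁, x + e₀) = |k|⁻¹ Σ_κ conj θ₀ θ₁ Q κ (x̄+e₁, x̄+e₀)`. [folklore] -/
private theorem blochMatrix_step_one_zero (x : FermionTorus 2 L) :
    blochMatrix hkM Q (stepSite x 1) (stepSite x 0) = ((Fintype.card (RectTorusSite k) : ℂ))⁻¹ *
      ∑ κ, conj (facePhase κ 0 (cellPos hkM x)) * facePhase κ 1 (cellPos hkM x) *
        Q κ (cellPos hkM x + Pi.single 1 1) (cellPos hkM x + Pi.single 0 1) := by
  rw [blochMatrix_apply]
  congr 1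
  refine Finset.sum_congr rfl fun κ _ => ?_
  rw [← sub_sub_sub_cancel_right (cellIndex hkM (stepSite x 1)) (cellIndex hkM (stepSite x 0))
      (cellIndex hkM x), blockChar_sub_right, blockChar_cellIndex_stepSite_sub hkM,
    blockChar_cellIndex_stepSite_sub hkM, cellPos_stepSite hkM, cellPos_stepSite hkM,
    mul_comm (facePhase κ 1 _)]

/-- **The Hartree–Fock energy of the diagonal bonds of a collinear Bloch state is the cell expression
`blochDiag`**: `hfEnergy (diagonal graph) t' 0 (P↑ ⊕ P↓) = -t' · blochDiag Q` for the Bloch matrices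
`P_σ` of the blocks `Q σ` (`L ≥ 3`). [cite: BachLiebSolovej1994, eq. (2c.8)] -/
theorem hfEnergy_diag_blochState (hL : 3 ≤ L) (t' : ℝ)
    (Q : Fin 2 → RectTorusSite k → Matrix (RectTorusSite M) (RectTorusSite M) ℂ) :
    hfEnergy (fermionTorusDiagGraph L) t' 0 (spinBlock fun σ => blochMatrix hkM (Q σ)) =
      -(t' : ℂ) * blochDiag Q := by
  set c : ℂ := (Fintype.card (RectTorusSite k) : ℂ) with hc
  have hc0 : c ≠ 0 := card_cells_ne_zero
  have hcollect : ∀ A B C D : ℂ, c * (c⁻¹ * A + c⁻¹ * B + c⁻¹ * C + c⁻¹ * D) = A + B + C + D := by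
    intro A B C D
    rw [mul_add, mul_add, mul_add, ← mul_assoc, ← mul_assoc, ← mul_assoc, ← mul_assoc,
      mul_inv_cancel₀ hc0]
    ring
  rw [hfEnergy_spinBlock, Complex.ofReal_zero, zero_mul, add_zero, blochDiag]
  simp_rw [trace_hopMatrix_diag_mul_eq hL]
  rw [← Finset.mul_sum]
  congr 1
  refine Finset.sum_congr rfl fun σ _ => ?_
  rw [sum_eq_sum_cell (A := ℂ) hkM]
  simp only [blochMatrix_diag_left, blochMatrix_diag_right, blochMatrix_step_zero_one,
    blochMatrix_step_one_zero, cellPos_ofCellPos]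
  rw [Finset.sum_const, Finset.card_univ, nsmul_eq_mul, ← hc]
  conv_rhs => rw [Finset.sum_comm]
  rw [Finset.mul_sum]
  refine Finset.sum_congr rfl fun p _ => ?_
  rw [Finset.sum_add_distrib, Finset.sum_add_distrib, Finset.sum_add_distrib]
  exact hcollect _ _ _ _

/-! ### The upper bound on the `t–t'` torus -/

include hkM in
/-- **Hartree–Fock upper bound from a Bloch (magnetic-cell) Slater state, `t–t'` Hubbard model.**
On the torus `(ℤ/Lℤ)²`, `L ≥ 3`, cut into `k 0 · k 1` cells of sides `M i` (`k i · M i = L`): for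
every family of Hermitian idempotent cell-momentum blocks `Q σ κ` with `Σ_{σ,κ} tr Q σ κ = N`,
`E_{(ℤ/Lℤ)²}(t, t', U; N) ≤ re blochEnergyTT' t t' U Q = re [blochEnergy t U Q - t' blochDiag Q]`
(the Slater determinant with one-body projection `P↑ ⊕ P↓`, `P_σ` the Bloch matrix of `Q σ`, through
the quasi-free ground state of `dΓ(1 - 2P)`; BLS94 (2c.36) with `γ` this projection, for the
two-graph Hamiltonian). [cite: BachLiebSolovej1994, eq. (2c.36)] -/
theorem hubbardTorusTT'_groundEnergy_le_blochTT' (hL : 3 ≤ L) (t t' U : ℝ)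
    (Q : Fin 2 → RectTorusSite k → Matrix (RectTorusSite M) (RectTorusSite M) ℂ)
    (hQh : ∀ σ κ, (Q σ κ).IsHermitian) (hQP : ∀ σ κ, Q σ κ * Q σ κ = Q σ κ) {N : ℕ}
    (hN : ∑ σ, ∑ κ, (Q σ κ).trace = N) :
    groundEnergy (hubbardTorusTT' L t t' U) N ≤ (blochEnergyTT' t t' U Q).re := by
  set P : Matrix (Orb (FermionTorus 2 L)) (Orb (FermionTorus 2 L)) ℂ :=
    spinBlock fun σ => blochMatrix hkM (Q σ) with hP
  have hPh : P.IsHermitian := by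
    rw [Matrix.IsHermitian, hP, conjTranspose_spinBlock]
    congr 1
    funext σ
    rw [conjTranspose_blochMatrix]
    congr 1
    funext κ
    exact (hQh σ κ).eq
  have hPP : P * P = P := by
    rw [hP, spinBlock_mul_spinBlock]
    congr 1
    funext σ
    rw [blochMatrix_mul]
    congr 1
    funext κ
    exact hQP σ κ
  have htr : P.trace = N := by
    rw [hP, trace_spinBlock]
    simp_rw [trace_blochMatrix]
    exact hN
  have key := groundEnergy_twoGraph_le_hfEnergy (fermionTorusGraph 2 L) (fermionTorusDiagGraph L)
    t U t' 0 hPh hPP htr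
  rw [hP, hfEnergy_blochState hkM hL, hfEnergy_diag_blochState hkM hL] at key
  rw [blochEnergyTT', sub_eq_add_neg, ← neg_mul]
  exact key

end Bloch

end HartreeFock

end Literature.MathematicalPhysics.QuantumLattice
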